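import Summits.KontsevichZagierPeriods.Zeta5Search.Barrier.ConeGammaTranslateDominanceSharp

/-!
# ζ(5) search — BARRIER: the desk note's IDENTITY — `Φ`-difference = static translate sum + `O(ε)`, TWO-SIDED

HONEST FRAMING (cell `pub-zeta5`): systematic search; no irrationality claim unless kernel-certified. MODEL objects
under Brown–Zudilin's (28)+(30) accounting ([BZ22] = arXiv:2210.03391; (28) observed, not proved); nothing here is a
statement about `ζ(5)`, about `γ`, or about the cone's supremum (C2 = `BarrierC2` OPEN; the lemma S-E with useful
constants CONJECTURED). The constants are lead/lit g27's `SE-DESK-NOTE.md` §2 NO-CANCELLATION constants at their own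
scale (by the note's §3(ii) still 3–20× over `BARRIER-PLAN.md` §2b's budget at `λ₀ = 60` for generic transversal
directions): this file says BY HOW MUCH the perturbation of `Φ` along a ray differs from the STATIC sum of rigid
translates — it says nothing about that static sum at any direction, nothing about cancellation. No number of record
moves; records in print UNMOVED. Prover P2 g20 (self-selected Lean-only item of the P2 lineage, file 4/4).

With `a_ε = aOfS(s(a) + εδ)`, `P(·) = translateIntegral a T ·`, `δ_k = (εkT)·δ`, `Y = shiftSize δ`,
`σ₁ = Σ_i |φ_i(δ)|`:

* **`abs_phi30_sub_sub_periodSum_le`** — the desk note's boxed IDENTITY `Φ(t₀+εv) − Φ(t₀) = H + M + E` as ONE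
  two-sided kernel inequality, HYPOTHESIS-FREE (no translate dominance, no Lemma B, no coherence radius): for `a` in
  the closed box with all forms positive, a period `T`, ANY `δ`, ANY `N ∈ ℕ` and every `0 ≤ ε` with `εT·Y ≤ 1`,
  `ε·Y ≤ x_min/2`, `a_ε` in the box,
  **`|Φ(a_ε) − Φ(a) − Σ_{k=1}^{N} (P(δ_k) − P(0))/(kT)²| ≤ ε·σ₁·(1 + log(T·x_max + 1)) + 4·ε·σ₁ + 7/((N+1)·T)`**
  (head `H` by `abs_head_integral_le_harmonic`; the within-period errors `E` by
  `abs_period_integral_sub_translate_le_sharp` + the telescoping `period_error_le`; truncation tail by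
  `abs_tail_integral_le`). `ConeGammaTranslateDominanceSharp.phi30_sub_le_of_translateDominance_sharp` is its corollary
  under translate dominance; P2 g19's `phi30_logCusp` is its `ε → 0` shadow inside Lemma B's radius.
Reading (structure, not a bound): two-sided S-E on the whole ball is EXACTLY the control of the static sums
`Σ_k (P(δ_k) − P(0))/(kT)²` — the kernel form of `BARRIER-PLAN.md` ADD. 18's «the G → Φ passage is elementary».
-/

noncomputable section

open Set MeasureTheory
open scoped Topology

namespace Summit.KontsevichZagierPeriods.Zeta5Search.Barrier.ConeGamma

/-- **The desk note's identity, two-sided, hypothesis-free.** See the module docstring: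
`|Φ(a_ε) − Φ(a) − Σ_{k=1}^{N} (P(εkT·δ) − P(0))/(kT)²| ≤ ε·σ₁·(1 + log(T·x_max + 1)) + 4·ε·σ₁ + 7/((N+1)·T)`
(the sum written over `k − 1 ∈ range N`). -/
theorem abs_phi30_sub_sub_periodSum_le {a : Dir} (ha : BZBox a) (hpos : ∀ k, 0 < h28 a k) {T : ℝ} (hT : 0 < T)
    (hper : ∀ k : Fin 28, ∃ z : ℤ, T * h28 a k = z) (δ : Fin 8 → ℝ) {ε : ℝ} (hε : 0 ≤ ε)
    (hεY : ε * T * shiftSize δ ≤ 1) (hεY2 : ε * shiftSize δ ≤ xMin a / 2)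
    (haε : BZBox (aOfS (sParam a + ε • δ))) (N : ℕ) :
    |phi30 (aOfS (sParam a + ε • δ)) - phi30 a
        - ∑ k ∈ Finset.range N, (translateIntegral a T ((ε * (((k : ℝ) + 1) * T)) • δ) - translateIntegral a T 0)
            / (((k : ℝ) + 1) * T) ^ 2|
      ≤ ε * (∑ i, |phiForm δ i|) * (1 + Real.log (T * xMax a + 1)) + 4 * (ε * ∑ i, |phiForm δ i|)
        + 7 / (((N : ℝ) + 1) * T) := by
  have hxM := xMax_pos hpos
  obtain ⟨S, hS⟩ : ∃ S : ℝ, S = ∑ i, |phiForm δ i| := ⟨_, rfl⟩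
  have hSnn : 0 ≤ S := by rw [hS]; exact Finset.sum_nonneg fun i _ => abs_nonneg _
  obtain ⟨C₁, hC₁⟩ : ∃ C₁ : ℝ, C₁ = T * S := ⟨_, rfl⟩
  have hC₁nn : 0 ≤ C₁ := by rw [hC₁]; exact mul_nonneg hT.le hSnn
  rw [← hS]
  have hNT : 0 < ((N : ℝ) + 1) * T := mul_pos (Nat.cast_add_one_pos N) hT
  -- the integrand in torus form and its integrability
  obtain ⟨g, hg⟩ : ∃ g : ℝ → ℝ,
      g = fun u => ((torusN (u • sParam a + (u * ε) • δ) : ℝ) - torusN (u • sParam a)) / u ^ 2 := ⟨_, rfl⟩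
  have hpert : ∀ u : ℝ, savingN (aOfS (sParam a + ε • δ)) u = torusN (u • sParam a + (u * ε) • δ) := by
    intro u; rw [savingN_eq_torusN_of_BZBox haε, sParam_aOfS, smul_add, smul_smul]
  have hF : phi30 (aOfS (sParam a + ε • δ)) - phi30 a = ∫ u in Ioi 0, g u := by
    unfold phi30
    rw [← integral_sub (integrableOn_savingN_div_sq haε) (integrableOn_savingN_div_sq ha)]
    refine setIntegral_congr_fun measurableSet_Ioi fun u _ => ?_
    simp only [hg, hpert u, savingN_eq_torusN_of_BZBox ha, sub_div]
  have hgint : IntegrableOn g (Ioi 0) := by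
    have h := (integrableOn_savingN_div_sq haε).sub (integrableOn_savingN_div_sq ha)
    refine h.congr_fun (fun u _ => ?_) measurableSet_Ioi
    simp only [hg, Pi.sub_apply, hpert u, savingN_eq_torusN_of_BZBox ha, sub_div]
  -- split `(0, ∞) = (0, (N+1)T] ∪ ((N+1)T, ∞)` and `(0, (N+1)T]` into periods
  have hsplit : ∫ u in Ioi 0, g u
      = (∫ u in (0 : ℝ)..(((N : ℝ) + 1) * T), g u) + ∫ u in Ioi (((N : ℝ) + 1) * T), g u := by
    rw [← Ioc_union_Ioi_eq_Ioi hNT.le, setIntegral_union Ioc_disjoint_Ioi_same measurableSet_Ioi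
      (hgint.mono_set Ioc_subset_Ioi_self) (hgint.mono_set (Ioi_subset_Ioi hNT.le)),
      intervalIntegral.integral_of_le hNT.le]
  have hperiods : ∫ u in (0 : ℝ)..(((N : ℝ) + 1) * T), g u
      = ∑ k ∈ Finset.range (N + 1), ∫ u in ((k : ℝ) * T)..(((k : ℝ) + 1) * T), g u := by
    have h := intervalIntegral.sum_integral_adjacent_intervals (a := fun k : ℕ => (k : ℝ) * T) (n := N + 1)
      (f := g) (μ := volume) fun k _ => ?_
    · simp only [Nat.cast_zero, zero_mul] at h
      push_cast at h
      rw [← h]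
    · have hk0 : (0 : ℝ) ≤ k * T := mul_nonneg (Nat.cast_nonneg k) hT.le
      rw [intervalIntegrable_iff_integrableOn_Ioc_of_le (by push_cast; nlinarith)]
      exact hgint.mono_set fun u hu => lt_of_le_of_lt hk0 hu.1
  have hsumsplit : ∑ k ∈ Finset.range (N + 1), (∫ u in ((k : ℝ) * T)..(((k : ℝ) + 1) * T), g u)
      = (∑ j ∈ Finset.range N, ∫ u in (((j : ℝ) + 1) * T)..(((j : ℝ) + 1 + 1) * T), g u)
        + ∫ u in (0 : ℝ)..T, g u := by
    rw [Finset.sum_range_succ']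
    simp only [Nat.cast_add, Nat.cast_one, Nat.cast_zero, zero_mul, zero_add, one_mul]
  -- (i) the head
  have hhead : |∫ u in (0 : ℝ)..T, g u| ≤ ε * S * (1 + Real.log (T * xMax a + 1)) := by
    rw [hg, hS]
    exact abs_head_integral_le_harmonic hpos hT δ hε hεY hεY2
  -- (ii) every period: the static translate term up to the telescoping error
  have hP : ∀ j ∈ Finset.range N,
      |(∫ u in (((j : ℝ) + 1) * T)..(((j : ℝ) + 1 + 1) * T), g u)
        - (translateIntegral a T ((ε * (((j : ℝ) + 1) * T)) • δ) - translateIntegral a T 0)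
            / (((j : ℝ) + 1) * T) ^ 2|
        ≤ (ε * C₁ / T) * (4 / (((j : ℝ) + 1) * ((j : ℝ) + 1 + 1))) := by
    intro j _
    have hper_k := abs_period_integral_sub_translate_le_sharp hpos hT hper δ hε (k := j + 1) (by omega)
    push_cast at hper_k
    rw [← hS, ← hC₁] at hper_k
    have hjnn : (0 : ℝ) ≤ (j : ℝ) := Nat.cast_nonneg j
    rw [hg]
    exact hper_k.trans (period_error_le hε hT hC₁nn (by linarith only [hjnn]))
  have hsum : |(∑ j ∈ Finset.range N, ∫ u in (((j : ℝ) + 1) * T)..(((j : ℝ) + 1 + 1) * T), g u)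
      - ∑ j ∈ Finset.range N, (translateIntegral a T ((ε * (((j : ℝ) + 1) * T)) • δ) - translateIntegral a T 0)
          / (((j : ℝ) + 1) * T) ^ 2| ≤ 4 * (ε * S) := by
    rw [← Finset.sum_sub_distrib]
    refine (Finset.abs_sum_le_sum_abs _ _).trans ((Finset.sum_le_sum hP).trans ?_)
    rw [← Finset.mul_sum]
    have h4 : ∑ j ∈ Finset.range N, 4 / (((j : ℝ) + 1) * ((j : ℝ) + 1 + 1))
        = 4 * ∑ j ∈ Finset.range N, 1 / (((j : ℝ) + 1) * ((j : ℝ) + 2)) := by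
      rw [Finset.mul_sum]
      refine Finset.sum_congr rfl fun j _ => ?_
      rw [show (j : ℝ) + 1 + 1 = (j : ℝ) + 2 by ring]
      field_simp
    rw [h4]
    have hs := sum_range_inv_mul_succ_le_one N
    have hC₁T : ε * C₁ / T = ε * S := by rw [hC₁]; field_simp
    rw [hC₁T]
    have hpos' : 0 ≤ ε * S := mul_nonneg hε hSnn
    nlinarith
  -- (iii) the tail
  have htail : |∫ u in Ioi (((N : ℝ) + 1) * T), g u| ≤ 7 / (((N : ℝ) + 1) * T) := by
    rw [hg]
    exact abs_tail_integral_le a δ ε hNT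
  -- (iv) assemble
  rw [hF, hsplit, hperiods, hsumsplit]
  have key : ∀ I₀ Sm Tl D : ℝ, |I₀| ≤ ε * S * (1 + Real.log (T * xMax a + 1)) → |Sm - D| ≤ 4 * (ε * S) →
      |Tl| ≤ 7 / (((N : ℝ) + 1) * T) →
      |Sm + I₀ + Tl - D| ≤ ε * S * (1 + Real.log (T * xMax a + 1)) + 4 * (ε * S) + 7 / (((N : ℝ) + 1) * T) := by
    intro I₀ Sm Tl D hI hSm hTl
    calc |Sm + I₀ + Tl - D| = |(Sm - D) + I₀ + Tl| := by ring_nf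
      _ ≤ |(Sm - D) + I₀| + |Tl| := abs_add_le _ _
      _ ≤ |Sm - D| + |I₀| + |Tl| := by linarith [abs_add_le (Sm - D) I₀]
      _ ≤ _ := by linarith
  exact key _ _ _ _ hhead hsum htail

end Summit.KontsevichZagierPeriods.Zeta5Search.Barrier.ConeGamma

end
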